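import Summits.BirchSwinnertonDyer.BirchSwinnertonDyer.Theorems.ManinLocalTwoThreeKatoShiftPrimeClassLattice
import Literature.NumberTheory.EllipticCurves.PAdicLFunctionIntegralityProofs
import Literature.NumberTheory.EllipticCurves.ModularFormsGamma0Genus

/-!
# Route `ManinLocalTwoThree`, crux C2 `ManinOddAtFour` (stmt-BirchSwinnertonDyer-22967), line `kato-shift-two`
# (es g7): the prime classes `{0, a/ℓ}_f` on the PLUS side — the real lattice coordinate
# `x(a) = Re{0,a/ℓ}_f/(Ω⁺_f/2) ∈ ℤ` is EVEN, and for an EVEN character `χ ≠ 1`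
# `Σ_a χ(a){∞,a/ℓ}_f = (Ω⁺_f/2)·Σ_a χ(a) x(a)` (line prover p1; helper)

The `p = 2` twin of `…KatoShiftPrimeClassLattice` (there: imaginary side, odd characters): `re Λ_f = ℤ·(Ω⁺_f/2)`
(`realPeriods_eq_zmultiples_of_plusPeriod_ne_zero`), `{∞,−r} = conj{∞,r}` for real coefficients, and
`Σ_a χ(a) = 0`, `a ↦ −a` remove `{∞,0}` and the imaginary parts for an even `χ ≠ 1`.
* `exists_int_re_primeClassZMod`, `re_primeClassZMod_neg`, `exists_latticeCoordPlus`;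
* `twistedSymbolSum_eq_sum_re_of_even`.
Nothing about BSD or Manin's conjecture is proved here.
-/

set_option autoImplicit false
set_option linter.dupNamespace false

noncomputable section

open scoped Classical MatrixGroups ModularForm

open CongruenceSubgroup Complex Literature.NumberTheory.EllipticCurves
  Literature.NumberTheory.EllipticCurves.ModularForms

namespace Summit.BirchSwinnertonDyer.BirchSwinnertonDyer.Theorems.ManinLocalTwoThree

section PlusSide

variable {N : ℕ} [NeZero N] (f : CuspForm (Gamma0 N) 2) {ℓ : ℕ}

/-- **Integrality of the real lattice coordinate**: for a prime `ℓ ∤ N` and `x ≠ 0` mod `ℓ`,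
`Re({∞, x̃/ℓ}_f − {∞, 0}_f) = n·(Ω⁺_f/2)` for an integer `n`, when `Ω⁺_f ≠ 0`. [folklore] -/
theorem exists_int_re_primeClassZMod (hℓ : ℓ.Prime) (hℓN : ¬ ℓ ∣ N) (hpos : plusPeriod f ≠ 0)
    (x : ZMod ℓ) (hx : x ≠ 0) :
    ∃ n : ℤ, (modularSymbol f (((x.val : ℕ) : ℚ) / ℓ) - modularSymbol f 0).re =
      n * (plusPeriod f / 2) := by
  have hmem : (modularSymbol f (((x.val : ℕ) : ℚ) / ℓ) - modularSymbol f 0).re ∈ realPeriods f :=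
    AddSubgroup.mem_map.mpr ⟨_, primeClassZMod_mem_periodLattice f hℓ hℓN x hx, rfl⟩
  rw [(realPeriods_eq_zmultiples_of_plusPeriod_ne_zero f hpos).1, AddSubgroup.mem_zmultiples_iff] at hmem
  obtain ⟨n, hn⟩ := hmem
  exact ⟨n, by rw [← hn, zsmul_eq_mul]⟩

/-- **Evenness**: `Re({∞, (−x)̃/ℓ} − {∞,0}) = Re({∞, x̃/ℓ} − {∞,0})` for `f` with real coefficients
(`{∞, −r}_f = conj {∞, r}_f`). [cite: CremonaAlgorithms1997, §2.8] -/
theorem re_primeClassZMod_neg (hℓ : ℓ ≠ 0) (hreal : ∀ n, (cuspCoeff f n).im = 0) (x : ZMod ℓ) :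
    (modularSymbol f ((((-x).val : ℕ) : ℚ) / ℓ) - modularSymbol f 0).re =
      (modularSymbol f (((x.val : ℕ) : ℚ) / ℓ) - modularSymbol f 0).re := by
  haveI : NeZero ℓ := ⟨hℓ⟩
  have hx : (-x) = ((-(x.val : ℤ) : ℤ) : ZMod ℓ) := by
    rw [Int.cast_neg, Int.cast_natCast, ZMod.natCast_zmod_val]
  have h1 : modularSymbol f ((((-x).val : ℕ) : ℚ) / ℓ) =
      modularSymbol f ((((-(x.val : ℤ) : ℤ)) : ℚ) / ℓ) := by
    conv_lhs => rw [hx]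
    exact modularSymbol_div_eq_of_intCast f hℓ _
  have h2 : ((((-(x.val : ℤ) : ℤ)) : ℚ) / ℓ) = -((((x.val : ℕ)) : ℚ) / ℓ) := by push_cast; ring
  rw [h1, h2, modularSymbol_neg_eq_conj_holds f hreal, Complex.sub_re, Complex.sub_re, Complex.conj_re]

/-- **Real lattice coordinates of the prime classes**: for the newform of a datum and a prime `ℓ ∤ N`
there is an EVEN integer-valued `x` on `ℤ/ℓ` with `Re({∞, ṽ/ℓ}_f − {∞,0}_f) = x(v)·(Ω⁺_f/2)`.
[cite: Manin1972, Prop. 1.4 / Thm. 1.6] [cite: CremonaAlgorithms1997, §2.8] -/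
theorem exists_latticeCoordPlus {W : WeierstrassCurve ℚ} (D : ModularParametrizationData W N)
    (hℓ : ℓ.Prime) (hℓN : ¬ ℓ ∣ N) :
    ∃ x : ZMod ℓ → ℤ,
      (∀ v : ZMod ℓ, (modularSymbol D.f (((v.val : ℕ) : ℚ) / ℓ) - modularSymbol D.f 0).re =
        x v * (plusPeriod D.f / 2)) ∧ (∀ v : ZMod ℓ, x (-v) = x v) := by
  haveI : NeZero ℓ := ⟨hℓ.ne_zero⟩
  have hreal : ∀ n, (cuspCoeff D.f n).im = 0 :=
    cuspCoeff_im_eq_zero_of_coeffField_eq_bot D.isNewformOf.coeffField_eq_bot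
  have hΩ : 0 < plusPeriod D.f :=
    IsNewform0.plusPeriod_pos_holds D.isNewformOf.1 D.isNewformOf.coeffField_eq_bot
  have hex : ∀ v : ZMod ℓ, ∃ n : ℤ,
      (modularSymbol D.f (((v.val : ℕ) : ℚ) / ℓ) - modularSymbol D.f 0).re =
        n * (plusPeriod D.f / 2) := by
    intro v
    by_cases hv : v = 0
    · refine ⟨0, ?_⟩
      subst hv
      simp [ZMod.val_zero]
    · exact exists_int_re_primeClassZMod D.f hℓ hℓN hΩ.ne' v hv
  choose x hx using hex
  refine ⟨x, hx, fun v ↦ ?_⟩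
  have h := re_primeClassZMod_neg D.f hℓ.ne_zero hreal v
  rw [hx, hx] at h
  have hne : plusPeriod D.f / 2 ≠ 0 := by positivity
  exact_mod_cast mul_right_cancel₀ hne h

/-- **The even twisted sum in real lattice coordinates**: for an EVEN character `χ ≠ 1` mod `ℓ` and `f`
with real coefficients, `Σ_a χ(a){∞, a/ℓ}_f = Σ_a χ(a)·Re({∞,a/ℓ}_f − {∞,0}_f)`
(`Σ_a χ(a) = 0` removes `{∞,0}`; `a ↦ −a` and `{∞,−r} = conj{∞,r}` remove the imaginary parts).
[cite: MazurTateTeitelbaum1986, §I.8] -/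
theorem twistedSymbolSum_eq_sum_re_of_even (hℓ : ℓ ≠ 0) (hreal : ∀ n, (cuspCoeff f n).im = 0)
    (χ : DirichletCharacter ℂ ℓ) (hχ : χ.Even) (hχ1 : χ ≠ 1) :
    haveI : NeZero ℓ := ⟨hℓ⟩
    twistedSymbolSum f χ =
      ∑ x : ZMod ℓ, χ x *
        (((modularSymbol f (((x.val : ℕ) : ℚ) / ℓ) - modularSymbol f 0).re : ℝ) : ℂ) := by
  haveI : NeZero ℓ := ⟨hℓ⟩
  set P : ZMod ℓ → ℂ := fun x ↦ modularSymbol f (((x.val : ℕ) : ℚ) / ℓ) - modularSymbol f 0 with hP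
  -- remove `{∞, 0}`
  have hT : twistedSymbolSum f χ = ∑ x : ZMod ℓ, χ x * P x := by
    unfold twistedSymbolSum
    have : ∑ x : ZMod ℓ, χ x * P x =
        ∑ x : ZMod ℓ, χ x * modularSymbol f (((x.val : ℕ) : ℚ) / ℓ) -
          (∑ x : ZMod ℓ, χ x) * modularSymbol f 0 := by
      simp only [hP, mul_sub, Finset.sum_sub_distrib, Finset.sum_mul]
    rw [this, MulChar.sum_eq_zero_of_ne_one hχ1, zero_mul, sub_zero]
  -- `P(−x) = conj (P x)`
  have hconj : ∀ x : ZMod ℓ, P (-x) = starRingEnd ℂ (P x) := by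
    intro x
    apply Complex.ext
    · rw [Complex.conj_re]
      exact re_primeClassZMod_neg f hℓ hreal x
    · rw [Complex.conj_im]
      exact im_primeClassZMod_neg f hℓ hreal x
  -- `Σ χ(x) conj(P x) = S` (even)
  have hS : ∑ x : ZMod ℓ, χ x * starRingEnd ℂ (P x) = ∑ x : ZMod ℓ, χ x * P x := by
    calc ∑ x : ZMod ℓ, χ x * starRingEnd ℂ (P x)
        = ∑ x : ZMod ℓ, χ x * P (-x) := by simp_rw [hconj]
      _ = ∑ x : ZMod ℓ, χ (-x) * P x := by
          rw [← Equiv.sum_comp (Equiv.neg (ZMod ℓ)) (fun x ↦ χ (-x) * P x)]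
          simp only [Equiv.neg_apply, neg_neg]
      _ = ∑ x : ZMod ℓ, χ x * P x := by
          refine Finset.sum_congr rfl fun x _ ↦ ?_
          rw [hχ.eval_neg]
  -- `P x = re + (P x − conj P x)/2`
  have hdec : ∀ x : ZMod ℓ, P x = (((P x).re : ℝ) : ℂ) + (P x - starRingEnd ℂ (P x)) / 2 := by
    intro x
    rw [Complex.sub_conj]
    apply Complex.ext <;> simp
  have h2 : ∑ x : ZMod ℓ, χ x * P x =
      ∑ x : ZMod ℓ, χ x * (((P x).re : ℝ) : ℂ) +
        (∑ x : ZMod ℓ, χ x * P x - ∑ x : ZMod ℓ, χ x * starRingEnd ℂ (P x)) / 2 := by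
    rw [← Finset.sum_sub_distrib, Finset.sum_div, ← Finset.sum_add_distrib]
    refine Finset.sum_congr rfl fun x _ ↦ ?_
    conv_lhs => rw [hdec x]
    ring
  rw [hT, h2, hS, sub_self, zero_div, add_zero]

end PlusSide

end Summit.BirchSwinnertonDyer.BirchSwinnertonDyer.Theorems.ManinLocalTwoThree

end
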